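import Mathlib

/-!
Triage scratch (refuter-cruxtri r2-1): bookkeeping behind the k = 5 kill of the monotone lever `T`
(card achiral-relator-reduction) recorded in Disproof.lean §13c — hole-incidence matrices of the two
positive factorisations `F = (t₂₃₄, t₁₂₃, t*₁₃₄, t₃)`, `F' = (t₂₃, t_∂₅, t₃₄, t*₁₃)` of one
`φ₀ ∈ Mod(P₅, ∂)`. `det = 2` for both ⇒ both planar Lefschetz fillings are ℚ-acyclic with
`H₁ = ℤ/2` (minimal length 4 = k - 1); the type multisets {234,123,134,3} / {23,1234,34,13} are
disjoint, so the signed type count of `F·F̄'` is nonzero and the word is not monotone reducible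
(`Disproof.not_monotoneReducible_of_typeCount_ne_zero`).
-/

open Matrix

/-- incidence matrix of `F`: rows = cycles 234, 123, 134, 3; columns = holes 1..4 -/
def MF : Matrix (Fin 4) (Fin 4) ℤ := !![0,1,1,1; 1,1,1,0; 1,0,1,1; 0,0,1,0]

/-- incidence matrix of `F'`: rows = cycles 23, 1234, 34, 13 -/
def MF' : Matrix (Fin 4) (Fin 4) ℤ := !![0,1,1,0; 1,1,1,1; 0,0,1,1; 1,0,1,0]

example : MF.det = 2 := by
  decide

example : MF'.det = 2 := by
  decide

/-- type vectors (sorted hole-subsets, encoded as naturals by binary digits 1..4) are disjoint -/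
example : Disjoint ({0b1110, 0b0111, 0b1101, 0b0100} : Finset ℕ) {0b0110, 0b1111, 0b1100, 0b0101} := by
  decide
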